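import Summits.Ventures.PercRepro.RankLevelSetContractMono
import Summits.Ventures.PercRepro.RankLevelSetFrameQM
import Summits.Ventures.PercRepro.RankLevelSetAC

/-!
# PercRepro — C-025 from the contraction monotonicity of the slack ON CORES ONLY (night-1, gen 7; C-037)

`c025_of_contractMonoExistsCore`: the hypothesis (MC∃) of `RankLevelSetContractMono` is needed only on the
CORE — simple, rank-`p`, coloop-free matroids in which every element admits an `e`-free partition, with
`q ≥ 1` and `|E| > p + q` (strictly above the tight layer).  Everything else is the cell's wrapper
(`rls_succ_all` of RankLevelSetFrameQ, re-run with a universal induction hypothesis): loops halve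
(`RLS_of_loop_q`), a parallel pair is Theorem F (`RLS_of_parallel_q`), `ρ(E) < p` is empty
(`RLS_of_eRank_lt`), `ρ(E) > p` truncates (`rls_of_truncate`, simplicity / rank / no coloop preserved), a
coloop is Lemma J₂ (`RLS_of_coloop_q`), an element without an `e`-free partition is Theorem F again
(`RLS_of_unspanned_q`), `|E| ≤ p + q` is Theorem M (`RLS_of_ncard_lt` / `RLS_of_ncard_eq`), `q = 0` is
Theorem A (`c025_of_q_zero`); on a core the element of (MC∃) gives `σ_M(p, q) ≥ σ_{M/e}(p − 1, q) ≥ 0`.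
The induction is a single strong induction on `|E|` for all pairs `(p, q)` at once.  Axioms: standard.
-/

open scoped Matroid

namespace PercRepro

namespace ThmN

open Set

variable {α : Type}

/-- **(MC∃) ON CORES**: for every simple, rank-`p`, coloop-free finite matroid in which every element admits an
`e`-free partition, every `q ≥ 1`, `q + 2 ≤ p` and `|E| > p + q`, some non-loop `e` has
`σ_{M ／ {e}}(p − 1, q) ≤ σ_M(p, q)`. -/
def ContractMonoExistsCore : Prop :=
  ∀ {α : Type} (M : Matroid α) [M.Finite] (p q : ℕ), 1 ≤ q → q + 2 ≤ p →
    (∀ e ∈ M.E, ∀ f ∈ M.E, e ≠ f → M.eRk {e, f} = 2) → M.eRank = (p : ℕ∞) →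
    (∀ e, ¬ M.IsColoop e) →
    (∀ e ∈ M.E, ∃ A ⊆ M.E \ {e}, e ∉ M.closure A ∧ e ∉ M.closure ((M.E \ {e}) \ A)) →
    p + q < M.E.ncard →
    ∃ e, M.IsNonloop e ∧ Matroid.slack (M ／ {e}) (p - 1) q ≤ Matroid.slack M p q

/-- (MC∃) implies its restriction to cores. -/
theorem contractMonoExistsCore_of_contractMonoExists (h : Matroid.ContractMonoExists) :
    ContractMonoExistsCore := by
  intro α M _ p q _ hpq _ hR _ _ _
  apply h M p q hpq
  -- a matroid of rank `p ≥ 2` has a non-loop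
  by_contra hno
  push Not at hno
  have hloop : ∀ e ∈ M.E, M.IsLoop e := fun e he =>
    (M.isLoop_or_isNonloop e he).resolve_right (hno e)
  have h0 : M.eRk M.E = 0 := by
    rw [Matroid.eRk_eq_zero_iff Subset.rfl]
    intro x hx
    exact hloop x hx
  rw [← Matroid.eRank_def] at h0
  rw [h0] at hR
  have : p = 0 := by exact_mod_cast hR.symm
  omega

/-- `RLS` is `0 ≤ slack`. -/
theorem RLS_iff_slack_nonneg (M : Matroid α) [M.Finite] (p q : ℕ) :
    RLS M p q ↔ 0 ≤ Matroid.slack M p q := by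
  rw [RLS_iff]
  unfold Matroid.slack
  constructor <;> intro h <;> linarith

/-- The core step: from the element of (MC∃) and `RLS` of the contraction at `(p − 1, q)`. -/
theorem RLS_of_contract_slack (M : Matroid α) [M.Finite] {p q : ℕ} (hpq : q + 2 ≤ p) {e : α}
    (hMC : Matroid.slack (M ／ {e}) (p - 1) q ≤ Matroid.slack M p q)
    (hIH : q + 2 ≤ p - 1 → RLS (M ／ {e}) (p - 1) q) : RLS M p q := by
  rw [RLS_iff_slack_nonneg]
  refine le_trans ?_ hMC
  by_cases hp : q + 2 ≤ p - 1
  · rw [← RLS_iff_slack_nonneg]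
    exact hIH hp
  · have hp' : p - 1 = q + 1 := by omega
    rw [hp']
    exact Matroid.slack_succ_self_nonneg _ q

/-- **C-025 FROM (MC∃) ON CORES** — strong induction on `|E|` for all `(p, q)` at once, the cell's
reductions for everything that is not a core strictly above the tight layer. -/
theorem c025_of_contractMonoExistsCore (hcore : ContractMonoExistsCore) : C025 := by
  suffices H : ∀ n : ℕ, ∀ {α : Type} (M : Matroid α) [M.Finite], M.E.ncard = n → ∀ p q : ℕ, q + 2 ≤ p →
      RLS M p q by
    intro α M _ p q hpq
    exact H _ M rfl p q hpq
  intro n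
  induction n using Nat.strong_induction_on with
  | _ n ih =>
  intro α M _ hn p q hpq
  classical
  -- `q = 0` is Theorem A
  rcases Nat.eq_zero_or_pos q with hq0 | hq1
  · subst hq0
    exact c025_of_q_zero (M := M) p
  have hdel : ∀ e ∈ M.E, (M ＼ {e}).E.ncard < n := by
    intro e he
    rw [_root_.Matroid.delete_ground, ← hn, ← Set.ncard_sdiff_singleton_add_one he M.ground_finite]
    omega
  have hcon : ∀ e ∈ M.E, (M ／ {e}).E.ncard < n := by
    intro e he
    rw [_root_.Matroid.contract_ground, ← hn, ← Set.ncard_sdiff_singleton_add_one he M.ground_finite]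
    omega
  -- Case 1: a loop
  by_cases hL : ∃ e ∈ M.E, M.IsLoop e
  · obtain ⟨e, he, hloopE⟩ := hL
    exact RLS_of_loop_q M hloopE p q (ih _ (hdel e he) (M ＼ {e}) rfl p q hpq)
  push Not at hL
  -- Case 2: a parallel pair
  by_cases hP : ∃ e ∈ M.E, ∃ e' ∈ M.E, e' ≠ e ∧ e ∈ M.closure {e'}
  · obtain ⟨e, he, e', he', hne, hpar⟩ := hP
    have heI : M.Indep {e} := _root_.Matroid.indep_singleton.2 ((_root_.Matroid.not_isLoop_iff he).1 (hL e he))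
    obtain ⟨p', rfl⟩ : ∃ p', p = p' + 1 := ⟨p - 1, by omega⟩
    obtain ⟨q', rfl⟩ : ∃ q', q = q' + 1 := ⟨q - 1, by omega⟩
    exact RLS_of_parallel_q M heI he' hne hpar (ih _ (hdel e he) (M ＼ {e}) rfl (p' + 1) (q' + 1) hpq)
      (ih _ (hcon e he) (M ／ {e}) rfl p' q' (by omega))
  push Not at hP
  -- Case 3: simple
  have hs : ∀ e ∈ M.E, ∀ f ∈ M.E, e ≠ f → M.eRk {e, f} = 2 :=
    fun e he f hf hef => eRk_pair_eq_two_of_simple M hL (fun e he e' he' hne => hP e he e' he' hne) he hf hef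
  -- the tight layer and below: Theorem M
  rcases lt_trichotomy M.E.ncard (p + q) with hsmall | htight | hbig
  · exact RLS_of_ncard_lt M hsmall
  · exact RLS_of_ncard_eq M htight
  rcases lt_trichotomy M.eRank (p : ℕ∞) with hlt | heq | hgt
  · exact RLS_of_eRank_lt M hlt
  · -- `ρ(E) = p`
    by_cases hC : ∃ e, M.IsColoop e
    · obtain ⟨e, hcol⟩ := hC
      obtain ⟨p', rfl⟩ : ∃ p', p = p' + 1 := ⟨p - 1, by omega⟩
      obtain ⟨q', rfl⟩ : ∃ q', q = q' + 1 := ⟨q - 1, by omega⟩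
      refine RLS_of_coloop_q M (by omega) hcol heq ?_
      rcases Nat.lt_or_ge (q' + 2) p' with h | h
      · exact ih _ (hdel e hcol.mem_ground) (M ＼ {e}) rfl p' (q' + 1) (by omega)
      · exact RLS_of_le (M ＼ {e}) (by omega)
    · push Not at hC
      -- an element without an `e`-free partition closes the step
      by_cases hU : ∃ e ∈ M.E, ∀ A ⊆ M.E \ {e}, e ∈ M.closure A ∨ e ∈ M.closure ((M.E \ {e}) \ A)
      · obtain ⟨e, he, hunsp⟩ := hU
        have heI : M.Indep {e} := _root_.Matroid.indep_singleton.2 ((_root_.Matroid.not_isLoop_iff he).1 (hL e he))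
        obtain ⟨p', rfl⟩ : ∃ p', p = p' + 1 := ⟨p - 1, by omega⟩
        obtain ⟨q', rfl⟩ : ∃ q', q = q' + 1 := ⟨q - 1, by omega⟩
        exact RLS_of_unspanned_q M heI hunsp (ih _ (hdel e he) (M ＼ {e}) rfl (p' + 1) (q' + 1) hpq)
          (ih _ (hcon e he) (M ／ {e}) rfl p' q' (by omega))
      · push Not at hU
        -- the core: the element of (MC∃)
        obtain ⟨e, he, hMC⟩ := hcore M p q hq1 hpq hs heq hC (fun e he => by
          obtain ⟨A, hA, h⟩ := hU e he
          exact ⟨A, hA, h.1, h.2⟩) hbig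
        exact RLS_of_contract_slack M hpq hMC
          (fun hp => ih _ (hcon e he.mem_ground) (M ／ {e}) rfl (p - 1) q hp)
  · -- `ρ(E) > p`: truncate, then the same dichotomy on the truncation (same ground set)
    have hp2 : 2 ≤ p := by omega
    set T := Matroid.truncate M p with hTdef
    have hTs := truncate_pair_eRk M hp2 hs
    have hTR := truncate_eRank_eq M hgt
    have hTc := truncate_no_coloop M hgt
    have hTE : T.E = M.E := Matroid.truncate_ground M p
    have hTn : T.E.ncard = n := by rw [hTE, hn]
    have hTbig : p + q < T.E.ncard := by rw [hTE]; exact hbig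
    have hconT : ∀ e ∈ T.E, (T ／ {e}).E.ncard < n := by
      intro e he
      rw [_root_.Matroid.contract_ground, ← hTn, ← Set.ncard_sdiff_singleton_add_one he T.ground_finite]
      omega
    have hdelT : ∀ e ∈ T.E, (T ＼ {e}).E.ncard < n := by
      intro e he
      rw [_root_.Matroid.delete_ground, ← hTn, ← Set.ncard_sdiff_singleton_add_one he T.ground_finite]
      omega
    have hT : RLS T p q := by
      by_cases hU : ∃ e ∈ T.E, ∀ A ⊆ T.E \ {e}, e ∈ T.closure A ∨ e ∈ T.closure ((T.E \ {e}) \ A)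
      · obtain ⟨e, he, hunsp⟩ := hU
        have heT : T.Indep {e} := by
          rw [Matroid.truncate_indep_iff]
          refine ⟨_root_.Matroid.indep_singleton.2 ((_root_.Matroid.not_isLoop_iff (hTE ▸ he)).1 (hL e (hTE ▸ he))), ?_⟩
          rw [Set.ncard_singleton]; omega
        obtain ⟨p', rfl⟩ : ∃ p', p = p' + 1 := ⟨p - 1, by omega⟩
        obtain ⟨q', rfl⟩ : ∃ q', q = q' + 1 := ⟨q - 1, by omega⟩
        exact RLS_of_unspanned_q T heT hunsp (ih _ (hdelT e he) (T ＼ {e}) rfl (p' + 1) (q' + 1) hpq)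
          (ih _ (hconT e he) (T ／ {e}) rfl p' q' (by omega))
      · push Not at hU
        obtain ⟨e, he, hMC⟩ := hcore T p q hq1 hpq hTs hTR hTc (fun e he => by
          obtain ⟨A, hA, h⟩ := hU e he
          exact ⟨A, hA, h.1, h.2⟩) hTbig
        exact RLS_of_contract_slack T hpq hMC
          (fun hp => ih _ (hconT e he.mem_ground) (T ／ {e}) rfl (p - 1) q hp)
    unfold RLS at hT ⊢
    exact Matroid.rls_of_truncate M p (by omega) (phiK p q) (by unfold phiK; positivity) hT

/-- **C-025 FROM (MC∃)** (again, through the core version). -/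
theorem c025_of_contractMonoExists' (h : Matroid.ContractMonoExists) : C025 :=
  c025_of_contractMonoExistsCore (contractMonoExistsCore_of_contractMonoExists h)

end ThmN

end PercRepro
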